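import Literature.NumberTheory.ComplexMultiplication.FiniteQAlgebraLatticeSquareZeroRadical
import Literature.NumberTheory.ComplexMultiplication.FiniteQAlgebraLatticeDimensionTwo
import HarnessLib

/-!
# Hertling–Larabi 2026b THEOREM 9.1 (a), (b), (d): full lattices in the split algebra `A = ℚe₁ ⊕ ℚe₂` —
# the orders `Λ_α = ⟨αe₁, e₁ + e₂⟩_ℤ` (`α ∈ ℕ`), the normal form `L_δ = ⟨e₁, δe₁ + e₂⟩_ℤ` (`δ ∈ [0, ½] ∩ ℚ`) of an
# `ε`-class, `𝒪(L_δ) = Λ_{den δ}`, and the class number `|G([Λ_α]_ε)| = φ(α)/2` (`α ≥ 3`), `= 1` (`α ∈ {1, 2}`)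

[topic NumberTheory/ComplexMultiplication] General-`A` series (namespace
`Literature.NumberTheory.ComplexMultiplication.FiniteQAlgebraLattice`), the simplest SPLIT example `A = ℚ × ℚ`
worked out with the tree's tools: `FiniteQAlgebraLatticeSquareZeroRadical` (`exists_map_eq_span_singleton`: a
projection of a finitely generated lattice is `ℤg`; `exists_intCast_eq_map_of_one_mem`: projections of orders are
integral), `FiniteQAlgebraLatticeWeakEquivalence` (`div_self_units_smul`: `𝒪(uL) = 𝒪(L)`),
`FiniteQAlgebraLatticeDimensionTwo` (`mul_div_div_eq_of_finrank_le_two`: in dimension `2` every full lattice is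
invertible, HL26b Cor. 4.15) — REUSED by name.  Companion of `LinearAlgebra/Matrix/GL2ZSingularNormalForms` (HL26b
Thm. 9.4, the matrix side of §9.2).  Lane `lit-hodgefound` (Track 2 foundations library), seat p19 generation 38,
row g38-#7.  THEOREMS ONLY: no definition, no instance, no notation, no named fact (D-0026, net Literature debt `0`),
no `sorry`.

DEF-FREE SPELLING.  `e₁ = (1, 0)`, `e₂ = (0, 1)`, `1_A = (1, 1)`; HL's `Λ_α := e(α 1; 0 1)·ℤ² = ℤαe₁ + ℤ(e₁ + e₂)` is
`span ℤ {((α : ℚ), 0), (1, 1)}` and `L_δ := e(1 δ; 0 1)·ℤ² = ℤe₁ + ℤ(δe₁ + e₂)` is `span ℤ {(1, 0), (δ, 1)}`; an ORDER is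
`IsFullLattice A Λ ∧ 1 ∈ Λ ∧ ΛΛ ⊆ Λ`; `𝒪(L) = L / L`; `[L]_ε ∋ L' ⟺ ∃ u : Aˣ, u • L = L'`; `G(Λ)` =
`{M // IsFullLattice A M ∧ M / M = Λ ∧ M * ((M / M) / M) = M / M}` and `G([Λ]_ε)` its `Quot` by `ε` (as in
`FiniteQAlgebraLatticeInvertibleClassesFinite` / `…ClassNumberFormula`); «`δ = β/α` in lowest terms» is `Rat.num`/`Rat.den`.

## Source, VERBATIM

C. Hertling, K. Larabi, *Conjugacy classes of regular integer matrices*, arXiv:2602.15748 (2026) [HertlingLarabi2026b],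
held `paper:arxiv-2602.15748`, §9.2 (chunks p0027–p0028): «**Theorem 9.1.** Let `A = ℚe_1 + ℚe_2` with
`e_ie_j = δ_{ij}e_i` for `i, j ∈ {1, 2}`. (a) Each order in `A` has a unique `ℤ`-basis `e(α 1; 0 1)` for some `α ∈ ℕ`.
Vice versa for each `α ∈ ℕ` `e(α 1; 0 1)` is a `ℤ`-basis of an order. So there is a 1:1 correspondence between the
set of orders and the set `ℕ`. (b) Each `ε`-class of full lattices contains a unique full lattice `L_δ` with a
`ℤ`-basis `e(1 δ; 0 1)` with `δ ∈ [0, ½] ∩ ℚ` (9.5). The `ℤ`-basis is unique. So there is a 1:1 correspondence between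
the set `𝓔(A)` and the set `[0, ½] ∩ ℚ`. Here an order with invariant `α ∈ ℕ` in part (a) corresponds to `1/α` if
`α ≥ 2` and to `0` if `α = 1` […]. (c) [the semigroup structure] (d) Each full lattice is invertible. For an order `Λ`
with `ℤ`-basis `e(α 1; 0 1)` the group of `ε`-classes of (automatically invertible) exact `Λ`-ideals is
`G([Λ]_ε) = {[L_δ]_ε | δ = β/α with β ∈ [0, ½α] ∩ ℤ, gcd(β, α) = 1} ≅ ℤ_α^{unit}/{±1}` if `α ≥ 3`, `{1}` if
`α ∈ {1, 2}`. Therefore `|G([Λ]_ε)| = φ(α)/2` if `α ≥ 3`, `1` if `α ∈ {1, 2}`. **Proof:** (a) A special case of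
(9.3). (b) A special case of (9.2). […] (d) Consider a full lattice `L_δ` as in (b) and an order `Λ` as in (a). Then
`Λ·L_δ` is generated over `ℤ` by `e(α αδ 1 δ; 0 0 0 1)`, so it is `L_δ` if and only if `αδ ∈ ℤ`. Also
`𝒪(L_δ) = Λ ⟺ α = 1` if `δ = 0`, `α = α̃` if `δ = β/α̃ ∈ (0, ½] ∩ ℚ` with `gcd(β, α̃) = 1` is clear now. […]»
((9.2)/(9.3), chunk p0027: each full lattice of `⊕ ℚe_i` has a unique triangular `ℚ`-basis `e(β_{ij})` with
`β_{ii} > 0`, `β_{ij} ∈ (−½β_{jj}, ½β_{jj}]`; the orders are those with … .)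

## What is proved (`A = ℚ × ℚ`)

* §0 `mem_span_normalForm_iff` (`(x, y) ∈ L_δ ⟺ y ∈ ℤ ∧ x − yδ ∈ ℤ`), `mem_span_order_iff`
  (`(x, y) ∈ Λ_α ⟺ y ∈ ℤ ∧ x ≡ y (mod α)`), `isFullLattice_span_normalForm`, `isFullLattice_span_order`,
  `isOrder_span_order` («Vice versa … is a `ℤ`-basis of an order»).
* §1 **THEOREM 9.1 (a)**: `exists_eq_span_order_of_isOrder` (every order is a `Λ_α`, `α ≥ 1`), `span_order_injective`
  (`α` is unique), `isOrder_iff_exists_eq_span_order` («1:1 correspondence between the set of orders and `ℕ`»).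
* §2 **THEOREM 9.1 (b)**: `exists_eq_span_pair_of_isFullLattice` (the triangular basis `(a, 0), (p, c)`),
  `span_normalForm_add_intCast` (`L_{δ+k} = L_δ`), `units_smul_span_normalForm_neg` (`(−1, 1)L_δ = L_{−δ}`),
  **`exists_units_smul_eq_span_normalForm`** (every `ε`-class contains an `L_δ`, `δ ∈ [0, ½]`) and
  **`normalForm_unique`** («a unique full lattice `L_δ`»).
* §3 **THEOREM 9.1 (d)**: `div_self_span_normalForm` (**`𝒪(L_δ) = Λ_{den δ}`**, i.e. `𝒪(L_{β/α̃}) = Λ_{α̃}`,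
  `𝒪(L_0) = Λ_1`), `mul_div_div_eq_of_isFullLattice_prod` («Each full lattice is invertible»).
* §4 **THEOREM 9.1 (d), the class number**: `card_filter_two_mul_le_coprime` / `natCard_two_mul_le_coprime`
  (`#{β ∈ [0, ½α] ∩ ℤ | gcd(β, α) = 1} = φ(α)/2` for `α ≥ 3`, `1` for `α ≤ 2`), and
  **`natCard_classGroup_span_order`: `|G([Λ_α]_ε)| = φ(α)/2` (`α ≥ 3`), `= 1` (`α ∈ {1, 2}`)**, through the bijection
  `[M]_ε ↦ β` (`uM = L_{β/α}`) of `G([Λ_α]_ε)` with `{β | 2β ≤ α, gcd(α, β) = 1}`.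
NOT here: (b)'s correspondence order `↦ 1/α` as a statement about `𝓔(A)`, (c) (the semigroup law
`[L_{δ₁}]·[L_{δ₂}] = [L_{δ₃}]`), and the identification `G([Λ_α]_ε) ≅ ℤ_α^{unit}/{±1}` as GROUPS (only its
cardinality).

## References

* [HertlingLarabi2026b] C. Hertling, K. Larabi, *Conjugacy classes of regular integer matrices*, arXiv:2602.15748
  (2026), §9.2 Theorem 9.1 with proof (chunks p0027–p0028), §9.1 (9.2)–(9.3) (chunk p0027), §4 Cor. 4.15 (chunk
  p0008). [cite: HertlingLarabi2026b, §9.2 Thm. 9.1 (a), (b), (d)]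
* [HertlingLarabi2026] C. Hertling, K. Larabi, *Semigroups from full lattices in commutative ℚ-algebras*,
  arXiv:2602.14973 (2026), §5 (orders, `ε`-classes, `G([Λ]_ε)`).
-/

noncomputable section

open scoped Pointwise
open Module Function Submodule

open Literature.NumberTheory.Automorphic (IsFullLattice mem_units_smul_submodule_iff)

namespace Literature.NumberTheory.ComplexMultiplication.FiniteQAlgebraLattice

section SplitRankTwo

/-! ## §0 The two families `Λ_α = ⟨(α,0), (1,1)⟩_ℤ`, `L_δ = ⟨(1,0), (δ,1)⟩_ℤ`: membership, fullness -/

/-- Membership in `L_δ = ℤ(1,0) + ℤ(δ,1)`: `(x, y) ∈ L_δ ⟺ y ∈ ℤ ∧ x − yδ ∈ ℤ`.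
[cite: HertlingLarabi2026b, §9.2 Theorem 9.1 (b) (9.5), chunk p0028] -/
theorem mem_span_normalForm_iff (δ x y : ℚ) :
    ((x, y) : ℚ × ℚ) ∈ span ℤ ({((1 : ℚ), (0 : ℚ)), (δ, 1)} : Set (ℚ × ℚ)) ↔
      (∃ n : ℤ, (n : ℚ) = y) ∧ ∃ m : ℤ, (m : ℚ) = x - y * δ := by
  rw [mem_span_pair]
  constructor
  · rintro ⟨a, b, hab⟩
    rw [Prod.ext_iff] at hab
    simp only [Prod.smul_mk, Prod.fst_add, Prod.snd_add, zsmul_eq_mul, mul_one, mul_zero, zero_add] at hab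
    obtain ⟨h1, h2⟩ := hab
    exact ⟨⟨b, h2⟩, a, by rw [← h1, ← h2]; ring⟩
  · rintro ⟨⟨n, hn⟩, m, hm⟩
    refine ⟨m, n, ?_⟩
    rw [Prod.ext_iff]
    simp only [Prod.smul_mk, Prod.fst_add, Prod.snd_add, zsmul_eq_mul, mul_one, mul_zero, zero_add]
    exact ⟨by rw [hm, hn]; ring, hn⟩

/-- Membership in `Λ_α = ℤ(α,0) + ℤ(1,1)`: `(x, y) ∈ Λ_α ⟺ y ∈ ℤ ∧ x − y ∈ αℤ` («`a ≡ b mod α`»).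
[cite: HertlingLarabi2026b, §9.2 Theorem 9.1 (a), chunk p0028] -/
theorem mem_span_order_iff (α : ℕ) (x y : ℚ) :
    ((x, y) : ℚ × ℚ) ∈ span ℤ ({((α : ℚ), (0 : ℚ)), (1, 1)} : Set (ℚ × ℚ)) ↔
      (∃ n : ℤ, (n : ℚ) = y) ∧ ∃ m : ℤ, (m : ℚ) * α = x - y := by
  rw [mem_span_pair]
  constructor
  · rintro ⟨a, b, hab⟩
    rw [Prod.ext_iff] at hab
    simp only [Prod.smul_mk, Prod.fst_add, Prod.snd_add, zsmul_eq_mul, mul_one, mul_zero, zero_add] at hab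
    obtain ⟨h1, h2⟩ := hab
    exact ⟨⟨b, h2⟩, a, by rw [← h1, ← h2]; ring⟩
  · rintro ⟨⟨n, hn⟩, m, hm⟩
    refine ⟨m, n, ?_⟩
    rw [Prod.ext_iff]
    simp only [Prod.smul_mk, Prod.fst_add, Prod.snd_add, zsmul_eq_mul, mul_one, mul_zero, zero_add]
    exact ⟨by rw [hn]; linear_combination hm, hn⟩

/-- A finitely generated `L ⊆ ℚ × ℚ` containing `(n, 0)` and `(0, n)` for some `n ≠ 0` is a full lattice. [folklore] -/
private theorem isFullLattice_of_mem {L : Submodule ℤ (ℚ × ℚ)} (hfg : L.FG) {n : ℤ} (hn : n ≠ 0)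
    (h1 : ((n : ℚ), (0 : ℚ)) ∈ L) (h2 : ((0 : ℚ), (n : ℚ)) ∈ L) : IsFullLattice (ℚ × ℚ) L := by
  refine ⟨hfg, fun d => ?_⟩
  obtain ⟨x, y⟩ := d
  refine ⟨n * (x.den * y.den : ℕ), mul_ne_zero hn (by exact_mod_cast mul_ne_zero x.den_nz y.den_nz), ?_⟩
  have e : ((n * (x.den * y.den : ℕ) : ℤ) • (x, y) : ℚ × ℚ) =
      (x.num * y.den : ℤ) • ((n : ℚ), (0 : ℚ)) + (y.num * x.den : ℤ) • ((0 : ℚ), (n : ℚ)) := by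
    rw [Prod.ext_iff]
    simp only [Prod.smul_mk, Prod.fst_add, Prod.snd_add, zsmul_eq_mul, mul_zero, add_zero, zero_add]
    push_cast
    constructor
    · calc (n : ℚ) * (x.den * y.den) * x = n * y.den * (x * x.den) := by ring
        _ = x.num * y.den * n := by rw [Rat.mul_den_eq_num]; ring
    · calc (n : ℚ) * (x.den * y.den) * y = n * x.den * (y * y.den) := by ring
        _ = y.num * x.den * n := by rw [Rat.mul_den_eq_num]; ring
  rw [e]
  exact add_mem (smul_mem _ _ h1) (smul_mem _ _ h2)

/-- `L_δ` is a full lattice. [cite: HertlingLarabi2026b, §9.2 Theorem 9.1 (b), chunk p0028] -/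
theorem isFullLattice_span_normalForm (δ : ℚ) :
    IsFullLattice (ℚ × ℚ) (span ℤ ({((1 : ℚ), (0 : ℚ)), (δ, 1)} : Set (ℚ × ℚ))) := by
  refine isFullLattice_of_mem (fg_span ((Set.finite_singleton _).insert _)) (n := δ.den)
    (by exact_mod_cast δ.den_nz) ?_ ?_
  · rw [mem_span_normalForm_iff]
    exact ⟨⟨0, by simp⟩, δ.den, by simp⟩
  · rw [mem_span_normalForm_iff]
    refine ⟨⟨δ.den, rfl⟩, -δ.num, ?_⟩
    push_cast
    rw [← Rat.den_mul_eq_num]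
    ring

/-- `Λ_α` (`α ≠ 0`) is a full lattice. [cite: HertlingLarabi2026b, §9.2 Theorem 9.1 (a), chunk p0028] -/
theorem isFullLattice_span_order {α : ℕ} (hα : α ≠ 0) :
    IsFullLattice (ℚ × ℚ) (span ℤ ({((α : ℚ), (0 : ℚ)), (1, 1)} : Set (ℚ × ℚ))) := by
  refine isFullLattice_of_mem (fg_span ((Set.finite_singleton _).insert _)) (n := (α : ℤ))
    (by exact_mod_cast hα) ?_ ?_
  · rw [Int.cast_natCast]
    exact subset_span (Set.mem_insert _ _)
  · rw [Int.cast_natCast, mem_span_order_iff]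
    exact ⟨⟨α, by simp⟩, -1, by ring⟩

/-- `1 = (1,1) ∈ Λ_α` and `Λ_α·Λ_α ⊆ Λ_α`: every `Λ_α` is multiplicatively closed with unit («Vice versa for each
`α ∈ ℕ`, `e(α 1; 0 1)` is a `ℤ`-basis of an order»). [cite: HertlingLarabi2026b, §9.2 Theorem 9.1 (a), chunk p0028] -/
theorem isOrder_span_order (α : ℕ) :
    (1 : ℚ × ℚ) ∈ span ℤ ({((α : ℚ), (0 : ℚ)), (1, 1)} : Set (ℚ × ℚ)) ∧
      span ℤ ({((α : ℚ), (0 : ℚ)), (1, 1)} : Set (ℚ × ℚ)) * span ℤ ({((α : ℚ), (0 : ℚ)), (1, 1)} : Set (ℚ × ℚ)) ≤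
        span ℤ ({((α : ℚ), (0 : ℚ)), (1, 1)} : Set (ℚ × ℚ)) := by
  refine ⟨subset_span (Set.mem_insert_of_mem _ rfl), ?_⟩
  rw [span_mul_span, span_le]
  rintro _ ⟨x, hx, y, hy, rfl⟩
  simp only [Set.mem_insert_iff, Set.mem_singleton_iff] at hx hy
  dsimp only
  rcases hx with rfl | rfl <;> rcases hy with rfl | rfl
  · rw [Prod.mk_mul_mk, mul_zero, SetLike.mem_coe, mem_span_order_iff]
    exact ⟨⟨0, by simp⟩, α, by push_cast; ring⟩
  · rw [Prod.mk_mul_mk, mul_one, mul_one]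
    exact subset_span (Set.mem_insert _ _)
  · rw [Prod.mk_mul_mk, one_mul, one_mul]
    exact subset_span (Set.mem_insert _ _)
  · rw [Prod.mk_mul_mk, one_mul]
    exact subset_span (Set.mem_insert_of_mem _ rfl)

/-! ## §1 THEOREM 9.1 (a): the orders of `ℚe₁ ⊕ ℚe₂` are the `Λ_α`, `α ∈ ℕ`, `α` unique -/

/-- **THEOREM 9.1 (a)** «Each order in `A` has a unique `ℤ`-basis `e(α 1; 0 1)` for some `α ∈ ℕ`»: an order
`Λ ⊂ ℚe₁ ⊕ ℚe₂` (full, `1 ∈ Λ`, `ΛΛ ⊆ Λ`) is `Λ_α = ℤ(α, 0) + ℤ(1, 1)` for some `α ≥ 1` — both coordinate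
projections of `Λ` are integral (finitely generated subrings of `ℚ`), and `{z ∈ ℤ | (z, 0) ∈ Λ} = αℤ`.
[cite: HertlingLarabi2026b, §9.2 Theorem 9.1 (a), chunk p0028] -/
theorem exists_eq_span_order_of_isOrder {Λ : Submodule ℤ (ℚ × ℚ)} (hΛ : IsFullLattice (ℚ × ℚ) Λ)
    (h1 : (1 : ℚ × ℚ) ∈ Λ) (hΛΛ : Λ * Λ ≤ Λ) :
    ∃ α : ℕ, 0 < α ∧ Λ = span ℤ ({((α : ℚ), (0 : ℚ)), (1, 1)} : Set (ℚ × ℚ)) := by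
  classical
  -- the ideal `I = {z ∈ ℤ | (z, 0) ∈ Λ}` is principal, `I = aℤ`, `a ≠ 0`
  set ι : ℤ →ₗ[ℤ] ℚ × ℚ := LinearMap.toSpanSingleton ℤ (ℚ × ℚ) ((1 : ℚ), (0 : ℚ)) with hι
  have hιz : ∀ z : ℤ, ι z = ((z : ℚ), (0 : ℚ)) := fun z => by
    rw [hι, LinearMap.toSpanSingleton_apply, Prod.smul_mk, zsmul_eq_mul, mul_one, smul_zero]
  set I : Ideal ℤ := Λ.comap ι with hI
  obtain ⟨a, ha⟩ := (IsPrincipalIdealRing.principal I).principal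
  have hmemI : ∀ z : ℤ, ((z : ℚ), (0 : ℚ)) ∈ Λ ↔ a ∣ z := fun z => by
    rw [← hιz, ← Submodule.mem_comap, ← hI, ha, Ideal.submodule_span_eq, Ideal.mem_span_singleton]
  -- both projections of `Λ` are integral
  have hfst : ∀ x ∈ Λ, ∃ m : ℤ, (m : ℚ) = x.1 := fun x hx =>
    exists_intCast_eq_map_of_one_mem (AlgHom.fst ℚ ℚ ℚ) hΛ.1 h1 hΛΛ hx
  have hsnd : ∀ x ∈ Λ, ∃ m : ℤ, (m : ℚ) = x.2 := fun x hx =>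
    exists_intCast_eq_map_of_one_mem (AlgHom.snd ℚ ℚ ℚ) hΛ.1 h1 hΛΛ hx
  -- `a ≠ 0` by fullness
  have ha0 : a ≠ 0 := by
    obtain ⟨n, hn, hnΛ⟩ := hΛ.2 ((1 : ℚ), (0 : ℚ))
    rw [Prod.smul_mk, zsmul_eq_mul, mul_one, smul_zero, hmemI] at hnΛ
    rintro rfl
    exact hn (zero_dvd_iff.1 hnΛ)
  set α : ℕ := a.natAbs with hα_def
  have hmemα : ∀ z : ℤ, ((z : ℚ), (0 : ℚ)) ∈ Λ ↔ (α : ℤ) ∣ z := fun z => by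
    rw [hmemI, hα_def, Int.natAbs_dvd]
  refine ⟨α, Int.natAbs_pos.2 ha0, le_antisymm (fun x hx => ?_) ?_⟩
  · obtain ⟨m, hm⟩ := hsnd x hx
    obtain ⟨k, hk⟩ := hfst x hx
    have hx0 : (((k - m : ℤ) : ℚ), (0 : ℚ)) ∈ Λ := by
      have e : (((k - m : ℤ) : ℚ), (0 : ℚ)) = x - m • (1 : ℚ × ℚ) := by
        rw [Prod.ext_iff]; simp [hk, hm]
      rw [e]
      exact sub_mem hx (smul_mem _ _ h1)
    obtain ⟨j, hj⟩ := (hmemα _).1 hx0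
    have e : x = (x.1, x.2) := rfl
    rw [e, mem_span_order_iff]
    refine ⟨⟨m, hm⟩, j, ?_⟩
    rw [← hk, ← hm, ← Int.cast_sub, hj]
    push_cast
    ring
  · rw [span_le]
    rintro v hv
    simp only [Set.mem_insert_iff, Set.mem_singleton_iff] at hv
    rcases hv with rfl | rfl
    · have h := (hmemα α).2 (dvd_refl _)
      rwa [Int.cast_natCast] at h
    · exact h1

/-- **THEOREM 9.1 (a), uniqueness of `α`**: `Λ_α = Λ_β ⟹ α = β` (`α, β ∈ ℕ`).
[cite: HertlingLarabi2026b, §9.2 Theorem 9.1 (a), chunk p0028] -/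
theorem span_order_injective {α β : ℕ}
    (h : span ℤ ({((α : ℚ), (0 : ℚ)), (1, 1)} : Set (ℚ × ℚ)) = span ℤ ({((β : ℚ), (0 : ℚ)), (1, 1)} : Set (ℚ × ℚ))) :
    α = β := by
  have key : ∀ {α β : ℕ}, span ℤ ({((α : ℚ), (0 : ℚ)), (1, 1)} : Set (ℚ × ℚ)) ≤
      span ℤ ({((β : ℚ), (0 : ℚ)), (1, 1)} : Set (ℚ × ℚ)) → β ∣ α := by
    intro α β hle
    have hmem : (((α : ℚ)), (0 : ℚ)) ∈ span ℤ ({((β : ℚ), (0 : ℚ)), (1, 1)} : Set (ℚ × ℚ)) :=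
      hle (subset_span (Set.mem_insert _ _))
    rw [mem_span_order_iff] at hmem
    obtain ⟨-, m, hm⟩ := hmem
    rw [sub_zero] at hm
    have hm' : m * (β : ℤ) = α := by exact_mod_cast hm
    exact Int.natCast_dvd_natCast.1 ⟨m, by rw [← hm']; ring⟩
  exact Nat.dvd_antisymm (key h.symm.le) (key h.le)

/-- **THEOREM 9.1 (a)** «So there is a 1:1 correspondence between the set of orders and the set `ℕ`»: `Λ` is an order of
`ℚe₁ ⊕ ℚe₂` iff `Λ = Λ_α` for a (unique, `span_order_injective`) `α ≥ 1`.
[cite: HertlingLarabi2026b, §9.2 Theorem 9.1 (a), chunk p0028] -/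
theorem isOrder_iff_exists_eq_span_order (Λ : Submodule ℤ (ℚ × ℚ)) :
    (IsFullLattice (ℚ × ℚ) Λ ∧ (1 : ℚ × ℚ) ∈ Λ ∧ Λ * Λ ≤ Λ) ↔
      ∃ α : ℕ, 0 < α ∧ Λ = span ℤ ({((α : ℚ), (0 : ℚ)), (1, 1)} : Set (ℚ × ℚ)) := by
  constructor
  · rintro ⟨hΛ, h1, hΛΛ⟩
    exact exists_eq_span_order_of_isOrder hΛ h1 hΛΛ
  · rintro ⟨α, hα, rfl⟩
    exact ⟨isFullLattice_span_order hα.ne', isOrder_span_order α⟩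

/-! ## §2 THEOREM 9.1 (b): every `ε`-class contains a unique `L_δ`, `δ ∈ [0, ½] ∩ ℚ` -/

/-- A finitely generated `ℤ`-submodule of `ℚ` is cyclic (image version). [folklore] -/
private theorem exists_map_eq_span_singleton_of_fg (f : (ℚ × ℚ) →ₗ[ℤ] ℚ) {L : Submodule ℤ (ℚ × ℚ)}
    (hL : L.FG) : ∃ g : ℚ, L.map f = span ℤ {g} := by
  classical
  set J : Submodule ℤ ℚ := L.map f with hJ
  have hJfg : J.FG := hL.map _
  let Jf : FractionalIdeal (nonZeroDivisors ℤ) ℚ := ⟨J, FractionalIdeal.isFractional_of_fg hJfg⟩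
  haveI hJp : (J : Submodule ℤ ℚ).IsPrincipal := FractionalIdeal.isPrincipal Jf
  exact ⟨Submodule.IsPrincipal.generator J, (Submodule.IsPrincipal.span_singleton_generator J).symm⟩

/-- **THEOREM 9.1 (b), raw basis**: a full lattice `L ⊂ ℚe₁ ⊕ ℚe₂` is `ℤ(a, 0) ⊕ ℤ(p, c)` with `a, c ≠ 0` — `ℤc` is
the second projection of `L`, `(p, c) ∈ L`, and `ℤa` is the image of `x ↦ x₁ − (p/c)x₂` (HL (9.2): a triangular
`ℚ`-basis `e(β₁₁ 0; β₂₁ β₂₂)`). [cite: HertlingLarabi2026b, §9.2 Theorem 9.1 (b) («a special case of (9.2)»), chunk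
p0028] -/
theorem exists_eq_span_pair_of_isFullLattice {L : Submodule ℤ (ℚ × ℚ)} (hL : IsFullLattice (ℚ × ℚ) L) :
    ∃ p c a : ℚ, c ≠ 0 ∧ a ≠ 0 ∧ ((p, c) : ℚ × ℚ) ∈ L ∧ L = span ℤ ({((a : ℚ), (0 : ℚ)), (p, c)} : Set (ℚ × ℚ)) := by
  classical
  -- second projection `snd(L) = ℤc`, `v = (p, c) ∈ L`, `c ≠ 0`
  obtain ⟨c, hc⟩ := exists_map_eq_span_singleton (AlgHom.snd ℚ ℚ ℚ) hL.1
  have hsnd : ∀ x ∈ L, x.2 ∈ span ℤ {c} := fun x hx => by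
    rw [← hc]
    exact ⟨x, hx, rfl⟩
  have hcmem : c ∈ L.map (((AlgHom.snd ℚ ℚ ℚ).toLinearMap).restrictScalars ℤ) := by
    rw [hc]; exact mem_span_singleton_self c
  obtain ⟨v, hvL, hvc⟩ := hcmem
  have hvc' : v.2 = c := hvc
  have hc0 : c ≠ 0 := by
    obtain ⟨x, hxL, hx⟩ := exists_mem_map_ne_zero (AlgHom.snd ℚ ℚ ℚ) hL
    obtain ⟨k, hk⟩ := mem_span_singleton.1 (hsnd x hxL)
    rintro rfl
    rw [smul_zero] at hk
    exact hx hk.symm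
  set p : ℚ := v.1 with hp
  have hv : v = (p, c) := Prod.ext rfl hvc'
  -- `φ = fst − (p/c)·snd` kills `v`; `φ(L) = ℤa`, `a ≠ 0`
  set φ : (ℚ × ℚ) →ₗ[ℤ] ℚ := (LinearMap.fst ℚ ℚ ℚ - (p / c) • LinearMap.snd ℚ ℚ ℚ).restrictScalars ℤ with hφ_def
  have hφ : ∀ x : ℚ × ℚ, φ x = x.1 - p / c * x.2 := fun x => by
    simp [hφ_def, smul_eq_mul]
  obtain ⟨a, ha⟩ := exists_map_eq_span_singleton_of_fg φ hL.1
  have hφmem : ∀ x ∈ L, φ x ∈ span ℤ {a} := fun x hx => by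
    rw [← ha]; exact ⟨x, hx, rfl⟩
  have ha0 : a ≠ 0 := by
    obtain ⟨n, hn, hnL⟩ := hL.2 ((1 : ℚ), (0 : ℚ))
    obtain ⟨k, hk⟩ := mem_span_singleton.1 (hφmem _ hnL)
    simp only [hφ, Prod.smul_mk, zsmul_eq_mul, mul_one, mul_zero, sub_zero] at hk
    rintro rfl
    rw [mul_zero] at hk
    exact hn (by exact_mod_cast hk.symm)
  have hsndZ : ∀ x ∈ L, ∃ n : ℤ, (n : ℚ) * c = x.2 := fun x hx => by
    obtain ⟨n, hn⟩ := mem_span_singleton.1 (hsnd x hx)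
    exact ⟨n, by rw [← hn, zsmul_eq_mul]⟩
  refine ⟨p, c, a, hc0, ha0, hv ▸ hvL, le_antisymm (fun x hx => ?_) ?_⟩
  · obtain ⟨n, hn⟩ := hsndZ x hx
    obtain ⟨m, hm⟩ := mem_span_singleton.1 (hφmem x hx)
    rw [zsmul_eq_mul, hφ] at hm
    have e : x = m • (((a : ℚ), (0 : ℚ)) : ℚ × ℚ) + n • ((p, c) : ℚ × ℚ) := by
      rw [Prod.ext_iff]
      simp only [Prod.smul_mk, Prod.fst_add, Prod.snd_add, zsmul_eq_mul, mul_zero, zero_add]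
      refine ⟨?_, hn.symm⟩
      rw [hm, ← hn]
      field_simp
      ring
    rw [e]
    exact add_mem (smul_mem _ _ (subset_span (Set.mem_insert _ _)))
      (smul_mem _ _ (subset_span (Set.mem_insert_of_mem _ rfl)))
  · rw [span_le]
    rintro w hw
    simp only [Set.mem_insert_iff, Set.mem_singleton_iff] at hw
    rcases hw with rfl | rfl
    · -- `(a, 0) = x − n·v` for some `x ∈ L` with `φ x = a`
      have hamem : a ∈ L.map φ := by rw [ha]; exact mem_span_singleton_self a
      obtain ⟨x, hxL, hxa⟩ := hamem
      obtain ⟨n, hn⟩ := hsndZ x hxL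
      have e : (((a : ℚ), (0 : ℚ)) : ℚ × ℚ) = x - n • v := by
        rw [hv, Prod.ext_iff]
        simp only [Prod.fst_sub, Prod.snd_sub, Prod.smul_mk, zsmul_eq_mul, ← hxa, hφ, ← hn]
        constructor
        · field_simp
        · ring
      rw [SetLike.mem_coe, e]
      exact sub_mem hxL (smul_mem _ _ hvL)
    · rw [SetLike.mem_coe, ← hv]
      exact hvL

/-- A unit `u` of `ℚe₁ ⊕ ℚe₂` moves `⟨v, w⟩_ℤ` to `⟨uv, uw⟩_ℤ`. [folklore] -/
private theorem units_smul_span_pair (u : (ℚ × ℚ)ˣ) (v w : ℚ × ℚ) :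
    u • span ℤ ({v, w} : Set (ℚ × ℚ)) = span ℤ ({(u : ℚ × ℚ) * v, (u : ℚ × ℚ) * w} : Set (ℚ × ℚ)) := by
  rw [Units.smul_def, Submodule.smul_span, Set.smul_set_insert, Set.smul_set_singleton, smul_eq_mul, smul_eq_mul]

/-- `L_{δ + k} = L_δ` for `k ∈ ℤ`. [cite: HertlingLarabi2026b, §9.2 Theorem 9.1 (b), chunk p0028] -/
theorem span_normalForm_add_intCast (δ : ℚ) (k : ℤ) :
    span ℤ ({((1 : ℚ), (0 : ℚ)), (δ + k, 1)} : Set (ℚ × ℚ)) = span ℤ ({((1 : ℚ), (0 : ℚ)), (δ, 1)} : Set (ℚ × ℚ)) := by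
  apply span_eq_span
  · rintro w hw
    simp only [Set.mem_insert_iff, Set.mem_singleton_iff] at hw
    rcases hw with rfl | rfl
    · exact subset_span (Set.mem_insert _ _)
    · rw [SetLike.mem_coe, mem_span_normalForm_iff]
      exact ⟨⟨1, by simp⟩, k, by ring⟩
  · rintro w hw
    simp only [Set.mem_insert_iff, Set.mem_singleton_iff] at hw
    rcases hw with rfl | rfl
    · exact subset_span (Set.mem_insert _ _)
    · rw [SetLike.mem_coe, mem_span_normalForm_iff]
      exact ⟨⟨1, by simp⟩, -k, by push_cast; ring⟩

/-- The sign unit `(−1, 1)` maps `L_δ` to `L_{−δ}`. [cite: HertlingLarabi2026b, §9.2 Theorem 9.1 (b), chunk p0028] -/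
theorem units_smul_span_normalForm_neg (δ : ℚ) {w : (ℚ × ℚ)ˣ} (hw : (w : ℚ × ℚ) = (-1, 1)) :
    w • span ℤ ({((1 : ℚ), (0 : ℚ)), (δ, 1)} : Set (ℚ × ℚ)) = span ℤ ({((1 : ℚ), (0 : ℚ)), (-δ, 1)} : Set (ℚ × ℚ)) := by
  rw [units_smul_span_pair, hw, Prod.mk_mul_mk, Prod.mk_mul_mk, mul_one, mul_zero, neg_one_mul, one_mul]
  apply span_eq_span
  · rintro w hw
    simp only [Set.mem_insert_iff, Set.mem_singleton_iff] at hw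
    rcases hw with rfl | rfl
    · rw [SetLike.mem_coe, mem_span_normalForm_iff]
      exact ⟨⟨0, by simp⟩, -1, by simp⟩
    · exact subset_span (Set.mem_insert_of_mem _ rfl)
  · rintro w hw
    simp only [Set.mem_insert_iff, Set.mem_singleton_iff] at hw
    rcases hw with rfl | rfl
    · have e : (((1 : ℚ), (0 : ℚ)) : ℚ × ℚ) = -((-1 : ℚ), (0 : ℚ)) := by simp
      rw [SetLike.mem_coe, e]
      exact neg_mem (subset_span (Set.mem_insert _ _))
    · exact subset_span (Set.mem_insert_of_mem _ rfl)

/-- **THEOREM 9.1 (b), existence** «Each `ε`-class of full lattices contains a […] full lattice `L_δ` with a `ℤ`-basis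
`e(1 δ; 0 1)` with `δ ∈ [0, ½] ∩ ℚ`»: for every full lattice `L` there are a unit `u ∈ (ℚe₁ ⊕ ℚe₂)^{unit}` and
`δ ∈ [0, ½] ∩ ℚ` with `uL = L_δ = ℤ(1,0) + ℤ(δ,1)` (scale by `(a⁻¹, c⁻¹)`, reduce `δ` modulo `1`, flip the sign by
`(−1, 1)`). [cite: HertlingLarabi2026b, §9.2 Theorem 9.1 (b), chunk p0028] -/
theorem exists_units_smul_eq_span_normalForm {L : Submodule ℤ (ℚ × ℚ)} (hL : IsFullLattice (ℚ × ℚ) L) :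
    ∃ u : (ℚ × ℚ)ˣ, ∃ δ : ℚ, 0 ≤ δ ∧ 2 * δ ≤ 1 ∧
      u • L = span ℤ ({((1 : ℚ), (0 : ℚ)), (δ, 1)} : Set (ℚ × ℚ)) := by
  obtain ⟨p, c, a, hc, ha, -, rfl⟩ := exists_eq_span_pair_of_isFullLattice hL
  -- the units `(a⁻¹, c⁻¹)` and `(−1, 1)`
  set u₀ : (ℚ × ℚ)ˣ := (Units.mkOfMulEqOne ((a, c) : ℚ × ℚ) (a⁻¹, c⁻¹)
    (by rw [Prod.mk_mul_mk, mul_inv_cancel₀ ha, mul_inv_cancel₀ hc]; rfl))⁻¹ with hu₀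
  have hu₀v : ((u₀ : (ℚ × ℚ)ˣ) : ℚ × ℚ) = (a⁻¹, c⁻¹) := rfl
  set w : (ℚ × ℚ)ˣ := Units.mkOfMulEqOne (((-1 : ℚ), (1 : ℚ)) : ℚ × ℚ) ((-1 : ℚ), (1 : ℚ))
    (by rw [Prod.mk_mul_mk]; norm_num) with hw_def
  have hw : (w : ℚ × ℚ) = (-1, 1) := rfl
  -- scale: `(a⁻¹, c⁻¹)·L = L_{p/a}`, then reduce `p/a` modulo `ℤ`
  set δ₀ : ℚ := p / a with hδ₀
  have h0 : u₀ • span ℤ ({((a : ℚ), (0 : ℚ)), (p, c)} : Set (ℚ × ℚ)) =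
      span ℤ ({((1 : ℚ), (0 : ℚ)), (Int.fract δ₀, 1)} : Set (ℚ × ℚ)) := by
    rw [units_smul_span_pair, hu₀v, Prod.mk_mul_mk, Prod.mk_mul_mk, inv_mul_cancel₀ ha, mul_zero,
      inv_mul_cancel₀ hc, ← Int.self_sub_floor, sub_eq_add_neg, ← Int.cast_neg, span_normalForm_add_intCast]
    congr 3
    rw [hδ₀, div_eq_inv_mul]
  by_cases hle : 2 * Int.fract δ₀ ≤ 1
  · exact ⟨u₀, Int.fract δ₀, Int.fract_nonneg δ₀, hle, h0⟩
  · refine ⟨w * u₀, 1 - Int.fract δ₀, by linarith [Int.fract_lt_one δ₀], by linarith, ?_⟩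
    rw [mul_smul, h0, units_smul_span_normalForm_neg _ hw, show (1 : ℚ) - Int.fract δ₀ = -Int.fract δ₀ + (1 : ℤ) by
      push_cast; ring, span_normalForm_add_intCast]

/-- **THEOREM 9.1 (b), uniqueness** «Each `ε`-class of full lattices contains a unique full lattice `L_δ`»: if a unit
`u = (u₁, u₂)` maps `L_δ` onto `L_{δ'}` with `δ, δ' ∈ [0, ½]`, then `δ = δ'` (`u₁, u₂ ∈ ℤ^× = {±1}` and
`δ ≡ ±δ' (mod 1)`). [cite: HertlingLarabi2026b, §9.2 Theorem 9.1 (b), chunk p0028] -/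
theorem normalForm_unique {δ δ' : ℚ} (hδ : 0 ≤ δ) (hδ1 : 2 * δ ≤ 1) (hδ' : 0 ≤ δ') (hδ'1 : 2 * δ' ≤ 1)
    {u : (ℚ × ℚ)ˣ} (h : u • span ℤ ({((1 : ℚ), (0 : ℚ)), (δ, 1)} : Set (ℚ × ℚ)) =
      span ℤ ({((1 : ℚ), (0 : ℚ)), (δ', 1)} : Set (ℚ × ℚ))) : δ = δ' := by
  -- the images of the basis vectors under `u` and `u⁻¹`
  have key : ∀ {u : (ℚ × ℚ)ˣ} {δ δ' : ℚ}, u • span ℤ ({((1 : ℚ), (0 : ℚ)), (δ, 1)} : Set (ℚ × ℚ)) =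
      span ℤ ({((1 : ℚ), (0 : ℚ)), (δ', 1)} : Set (ℚ × ℚ)) →
      (∃ m : ℤ, (m : ℚ) = (u : ℚ × ℚ).1) ∧ (∃ n : ℤ, (n : ℚ) = (u : ℚ × ℚ).2) ∧
        ∃ k : ℤ, (k : ℚ) = (u : ℚ × ℚ).1 * δ - (u : ℚ × ℚ).2 * δ' := by
    intro u δ δ' h
    have h1 : (u : ℚ × ℚ) * ((1 : ℚ), (0 : ℚ)) ∈ span ℤ ({((1 : ℚ), (0 : ℚ)), (δ', 1)} : Set (ℚ × ℚ)) := by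
      rw [← h, ← smul_eq_mul, ← Units.smul_def]
      exact smul_mem_pointwise_smul _ _ _ (subset_span (Set.mem_insert _ _))
    have h2 : (u : ℚ × ℚ) * ((δ : ℚ), (1 : ℚ)) ∈ span ℤ ({((1 : ℚ), (0 : ℚ)), (δ', 1)} : Set (ℚ × ℚ)) := by
      rw [← h, ← smul_eq_mul, ← Units.smul_def]
      exact smul_mem_pointwise_smul _ _ _ (subset_span (Set.mem_insert_of_mem _ rfl))
    have hu : (u : ℚ × ℚ) = ((u : ℚ × ℚ).1, (u : ℚ × ℚ).2) := rfl
    rw [hu, Prod.mk_mul_mk, mul_one, mul_zero, mem_span_normalForm_iff] at h1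
    rw [hu, Prod.mk_mul_mk, mul_one, mem_span_normalForm_iff] at h2
    obtain ⟨-, m, hm⟩ := h1
    rw [zero_mul, sub_zero] at hm
    obtain ⟨⟨n, hn⟩, k, hk⟩ := h2
    exact ⟨⟨m, hm⟩, ⟨n, hn⟩, k, hk⟩
  have h' : u⁻¹ • span ℤ ({((1 : ℚ), (0 : ℚ)), (δ', 1)} : Set (ℚ × ℚ)) =
      span ℤ ({((1 : ℚ), (0 : ℚ)), (δ, 1)} : Set (ℚ × ℚ)) := by
    rw [← h, inv_smul_smul]
  obtain ⟨⟨m, hm⟩, ⟨n, hn⟩, k, hk⟩ := key h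
  obtain ⟨⟨m', hm'⟩, ⟨n', hn'⟩, -⟩ := key h'
  have hinv1 : (u : ℚ × ℚ).1 * ((u⁻¹ : (ℚ × ℚ)ˣ) : ℚ × ℚ).1 = 1 := by
    rw [← Prod.fst_mul, ← Units.val_mul, mul_inv_cancel, Units.val_one, Prod.fst_one]
  have hinv2 : (u : ℚ × ℚ).2 * ((u⁻¹ : (ℚ × ℚ)ˣ) : ℚ × ℚ).2 = 1 := by
    rw [← Prod.snd_mul, ← Units.val_mul, mul_inv_cancel, Units.val_one, Prod.snd_one]
  rw [← hm, ← hm'] at hinv1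
  rw [← hn, ← hn'] at hinv2
  have hm1 : m = 1 ∨ m = -1 := Int.eq_one_or_neg_one_of_mul_eq_one (by exact_mod_cast hinv1)
  have hn1 : n = 1 ∨ n = -1 := Int.eq_one_or_neg_one_of_mul_eq_one (by exact_mod_cast hinv2)
  rw [← hm, ← hn] at hk
  -- `k = mδ − nδ'` with `m, n = ±1`, `δ, δ' ∈ [0, ½]`
  have hk1 : (k : ℚ) ≤ 1 := by rcases hm1 with rfl | rfl <;> rcases hn1 with rfl | rfl <;> push_cast at hk <;> linarith
  have hk2 : (-1 : ℚ) ≤ k := by rcases hm1 with rfl | rfl <;> rcases hn1 with rfl | rfl <;> push_cast at hk <;> linarith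
  have hkZ : k = -1 ∨ k = 0 ∨ k = 1 := by
    have h1 : k ≤ 1 := by exact_mod_cast hk1
    have h2 : -1 ≤ k := by exact_mod_cast hk2
    omega
  rcases hm1 with rfl | rfl <;> rcases hn1 with rfl | rfl <;> rcases hkZ with rfl | rfl | rfl <;>
    push_cast at hk <;> linarith

/-! ## §3 THEOREM 9.1 (d): `𝒪(L_δ) = Λ_α` for `δ = β/α` in lowest terms; every full lattice is invertible -/

/-- `zδ ∈ ℤ ⟺ den(δ) ∣ z` for an integer `z`. [folklore] -/
private theorem exists_intCast_eq_mul_iff_den_dvd (z : ℤ) (δ : ℚ) :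
    (∃ k : ℤ, (k : ℚ) = z * δ) ↔ (δ.den : ℤ) ∣ z := by
  constructor
  · rintro ⟨k, hk⟩
    -- `k·den = z·num`, and `gcd(num, den) = 1`
    have h : k * δ.den = z * δ.num := by
      have h' : (k : ℚ) * δ.den = z * δ.num := by rw [hk, mul_assoc, ← Rat.den_mul_eq_num]; ring
      exact_mod_cast h'
    rw [Int.natCast_dvd]
    have hdvd : δ.den ∣ z.natAbs * δ.num.natAbs := by
      rw [← Int.natAbs_mul, ← h, Int.natAbs_mul, Int.natAbs_natCast]
      exact Dvd.intro_left _ rfl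
    exact (Nat.Coprime.symm δ.reduced).dvd_of_dvd_mul_right hdvd
  · rintro ⟨j, rfl⟩
    refine ⟨j * δ.num, ?_⟩
    push_cast
    rw [mul_assoc, ← Rat.den_mul_eq_num]
    ring

/-- **THEOREM 9.1 (d) «`𝒪(L_δ) = Λ` ⟺ `α = 1` if `δ = 0`, `α = α̃` if `δ = β/α̃ ∈ (0, ½] ∩ ℚ` with
`gcd(β, α̃) = 1`»**: the order of `L_δ` is `Λ_{den δ}` (for every rational `δ`; `den 0 = 1`).
[cite: HertlingLarabi2026b, §9.2 Theorem 9.1 (d) (proof), chunk p0028] -/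
theorem div_self_span_normalForm (δ : ℚ) :
    span ℤ ({((1 : ℚ), (0 : ℚ)), (δ, 1)} : Set (ℚ × ℚ)) / span ℤ ({((1 : ℚ), (0 : ℚ)), (δ, 1)} : Set (ℚ × ℚ)) =
      span ℤ ({((δ.den : ℚ), (0 : ℚ)), (1, 1)} : Set (ℚ × ℚ)) := by
  refine le_antisymm (fun x hx => ?_) ?_
  · rw [Submodule.mem_div_iff_forall_mul_mem] at hx
    have h1 := hx _ (subset_span (Set.mem_insert _ _))
    have h2 := hx _ (subset_span (Set.mem_insert_of_mem _ rfl))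
    have ex : x = (x.1, x.2) := rfl
    rw [ex, Prod.mk_mul_mk, mul_one, mul_zero, mem_span_normalForm_iff] at h1
    rw [ex, Prod.mk_mul_mk, mul_one, mem_span_normalForm_iff] at h2
    obtain ⟨-, m, hm⟩ := h1
    rw [zero_mul, sub_zero] at hm
    obtain ⟨⟨n, hn⟩, k, hk⟩ := h2
    rw [ex, mem_span_order_iff]
    refine ⟨⟨n, hn⟩, ?_⟩
    have hint : ∃ k : ℤ, (k : ℚ) = (m - n : ℤ) * δ := ⟨k, by rw [hk, ← hm, ← hn]; push_cast; ring⟩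
    obtain ⟨j, hj⟩ := (exists_intCast_eq_mul_iff_den_dvd _ δ).1 hint
    refine ⟨j, ?_⟩
    rw [← hm, ← hn, ← Int.cast_sub, hj]
    push_cast
    ring
  · rw [Submodule.le_div_iff_mul_le, span_mul_span, span_le]
    rintro _ ⟨x, hx, y, hy, rfl⟩
    simp only [Set.mem_insert_iff, Set.mem_singleton_iff] at hx hy
    dsimp only
    rcases hx with rfl | rfl <;> rcases hy with rfl | rfl
    · rw [Prod.mk_mul_mk, mul_one, mul_zero, SetLike.mem_coe, mem_span_normalForm_iff]
      exact ⟨⟨0, by simp⟩, δ.den, by simp⟩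
    · rw [Prod.mk_mul_mk, zero_mul, Rat.den_mul_eq_num, SetLike.mem_coe, mem_span_normalForm_iff]
      exact ⟨⟨0, by simp⟩, δ.num, by simp⟩
    · rw [Prod.mk_mul_mk, one_mul, one_mul]
      exact subset_span (Set.mem_insert _ _)
    · rw [Prod.mk_mul_mk, one_mul, one_mul]
      exact subset_span (Set.mem_insert_of_mem _ rfl)

/-- **THEOREM 9.1 (d) «Each full lattice is invertible»** (`ℚe₁ ⊕ ℚe₂` is 2-dimensional: the tree's HL26b Cor. 4.15,
`mul_div_div_eq_of_finrank_le_two`): `L·(𝒪(L):L) = 𝒪(L)`. [cite: HertlingLarabi2026b, §9.2 Theorem 9.1 (d), chunk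
p0028] -/
theorem mul_div_div_eq_of_isFullLattice_prod {L : Submodule ℤ (ℚ × ℚ)} (hL : IsFullLattice (ℚ × ℚ) L) :
    L * ((L / L) / L) = L / L :=
  mul_div_div_eq_of_finrank_le_two (by rw [Module.finrank_prod, Module.finrank_self]) hL

/-! ## §4 THEOREM 9.1 (d): `|G([Λ_α]_ε)| = φ(α)/2` for `α ≥ 3`, `= 1` for `α ∈ {1, 2}` -/

/-- The arithmetic core: `#{β ∈ [0, ½α] ∩ ℤ | gcd(β, α) = 1} = φ(α)/2` (`α ≥ 3`; the involution `β ↦ α − β` of the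
`φ(α)` residues prime to `α` has no fixed point), `= 1` (`α ∈ {1, 2}`). [cite: HertlingLarabi2026b, §9.2 Theorem 9.1
(d) («`≅ ℤ_α^{unit}/{±1}` if `α ≥ 3`, `{1}` if `α ∈ {1, 2}`»), chunk p0028] -/
theorem card_filter_two_mul_le_coprime {α : ℕ} (hα : 0 < α) :
    ((Finset.range (α + 1)).filter (fun β => 2 * β ≤ α ∧ α.Coprime β)).card =
      if α ≤ 2 then 1 else Nat.totient α / 2 := by
  split_ifs with h2
  · interval_cases α <;> decide
  · push Not at h2
    set C := (Finset.range α).filter (fun β => α.Coprime β) with hC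
    have hφ : α.totient = C.card := Nat.totient_eq_card_coprime α
    have hS : (Finset.range (α + 1)).filter (fun β => 2 * β ≤ α ∧ α.Coprime β) = C.filter (fun β => 2 * β ≤ α) := by
      ext β
      simp only [hC, Finset.mem_filter, Finset.mem_range]
      constructor
      · rintro ⟨-, h2, h3⟩
        exact ⟨⟨by omega, h3⟩, h2⟩
      · rintro ⟨⟨-, h3⟩, h2⟩
        exact ⟨by omega, h2, h3⟩
    -- a residue prime to `α ≥ 3` is neither `0` nor `α/2`
    have hC' : ∀ β : ℕ, β ∈ C ↔ β < α ∧ α.Coprime β := fun β => by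
      rw [hC, Finset.mem_filter, Finset.mem_range]
    have hne : ∀ β : ℕ, α.Coprime β → 2 * β ≠ α := by
      intro β hβ h
      have h1 : β = 1 := Nat.Coprime.eq_one_of_dvd hβ.symm ⟨2, by omega⟩
      omega
    have h0 : ∀ β : ℕ, α.Coprime β → 0 < β := by
      intro β hβ
      by_contra h
      have hβ0 : β = 0 := by omega
      rw [hβ0, Nat.coprime_zero_right] at hβ
      omega
    -- `β ↦ α − β` swaps `{2β ≤ α}` and `{2β > α}` inside `C`
    have hbij : (C.filter (fun β => 2 * β ≤ α)).card = (C.filter (fun β => ¬ 2 * β ≤ α)).card := by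
      apply Finset.card_nbij' (fun β => α - β) (fun β => α - β)
      · intro β hβ
        simp only [Finset.coe_filter, Set.mem_setOf_eq, hC'] at hβ ⊢
        obtain ⟨⟨hβα, hcop⟩, hle⟩ := hβ
        have := h0 β hcop
        have := hne β hcop
        exact ⟨⟨by omega, (Nat.coprime_self_sub_right hβα.le).2 hcop⟩, by omega⟩
      · intro β hβ
        simp only [Finset.coe_filter, Set.mem_setOf_eq, hC'] at hβ ⊢
        obtain ⟨⟨hβα, hcop⟩, hle⟩ := hβ
        have := h0 β hcop
        exact ⟨⟨by omega, (Nat.coprime_self_sub_right hβα.le).2 hcop⟩, by omega⟩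
      · intro β hβ
        simp only [Finset.coe_filter, Set.mem_setOf_eq, hC'] at hβ
        show α - (α - β) = β
        omega
      · intro β hβ
        simp only [Finset.coe_filter, Set.mem_setOf_eq, hC'] at hβ
        show α - (α - β) = β
        omega
    have hsum := Finset.card_filter_add_card_filter_not (s := C) (fun β => 2 * β ≤ α)
    rw [hS]
    omega

/-- The same count as a `Nat.card`. [cite: HertlingLarabi2026b, §9.2 Theorem 9.1 (d), chunk p0028] -/
theorem natCard_two_mul_le_coprime {α : ℕ} (hα : 0 < α) :
    Nat.card {β : ℕ // 2 * β ≤ α ∧ α.Coprime β} = if α ≤ 2 then 1 else Nat.totient α / 2 := by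
  classical
  rw [← card_filter_two_mul_le_coprime hα]
  have e : {β : ℕ // 2 * β ≤ α ∧ α.Coprime β} ≃
      ((Finset.range (α + 1)).filter (fun β => 2 * β ≤ α ∧ α.Coprime β) : Finset ℕ) :=
    Equiv.subtypeEquivRight fun β => by
      simp only [Finset.mem_filter, Finset.mem_range]
      constructor
      · rintro ⟨h1, h2⟩
        exact ⟨by omega, h1, h2⟩
      · rintro ⟨-, h1, h2⟩
        exact ⟨h1, h2⟩
  rw [Nat.card_congr e, Nat.card_eq_fintype_card, Fintype.card_coe]

/-- `den(β/α) = α` and `num(β/α) = β` for `gcd(α, β) = 1`, `α > 0`. [folklore] -/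
private theorem den_div_eq_and_num_div_eq {α β : ℕ} (hα : 0 < α) (hcop : α.Coprime β) :
    ((β : ℚ) / α).den = α ∧ ((β : ℚ) / α).num = β := by
  have hcop' : (β : ℤ).natAbs.Coprime (α : ℤ).natAbs := by simpa [Int.natAbs_natCast] using hcop.symm
  have hα' : (0 : ℤ) < α := by exact_mod_cast hα
  have h1 := Rat.den_div_eq_of_coprime hα' hcop'
  have h2 := Rat.num_div_eq_of_coprime hα' hcop'
  have e : (((β : ℤ) : ℚ) / ((α : ℤ) : ℚ)) = (β : ℚ) / α := by simp
  rw [e] at h1 h2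
  exact ⟨by exact_mod_cast h1, h2⟩

/-- **THEOREM 9.1 (d)** «For an order `Λ` with `ℤ`-basis `e(α 1; 0 1)` the group of `ε`-classes of (automatically
invertible) exact `Λ`-ideals is `G([Λ]_ε) = {[L_δ]_ε | δ = β/α with β ∈ [0, ½α] ∩ ℤ, gcd(β, α) = 1}` […] Therefore
`|G([Λ]_ε)| = φ(α)/2` if `α ≥ 3`, `1` if `α ∈ {1, 2}`»: for `Λ_α = ℤ(α, 0) + ℤ(1, 1)`, `α ≥ 1`, the `ε`-classes
`{[M]_ε | M full, 𝒪(M) = Λ_α, M invertible}` (the tree's `G([Λ]_ε)`, as in `FiniteQAlgebraLatticeInvertibleClassesFinite`)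
are in bijection with `{β ∈ ℕ | 2β ≤ α, gcd(α, β) = 1}` via `[L_{β/α}]_ε ↤ β` (§§2–3), hence number `φ(α)/2`, resp. `1`.
[cite: HertlingLarabi2026b, §9.2 Theorem 9.1 (d), chunk p0028] -/
theorem natCard_classGroup_span_order {α : ℕ} (hα : 0 < α) :
    Nat.card (Quot fun M M' : {M : Submodule ℤ (ℚ × ℚ) // IsFullLattice (ℚ × ℚ) M ∧
        M / M = span ℤ ({((α : ℚ), (0 : ℚ)), (1, 1)} : Set (ℚ × ℚ)) ∧ M * ((M / M) / M) = M / M} =>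
      ∃ u : (ℚ × ℚ)ˣ, u • M.1 = M'.1) = if α ≤ 2 then 1 else Nat.totient α / 2 := by
  classical
  set G := {M : Submodule ℤ (ℚ × ℚ) // IsFullLattice (ℚ × ℚ) M ∧
    M / M = span ℤ ({((α : ℚ), (0 : ℚ)), (1, 1)} : Set (ℚ × ℚ)) ∧ M * ((M / M) / M) = M / M} with hG
  set r : G → G → Prop := fun M M' => ∃ u : (ℚ × ℚ)ˣ, u • M.1 = M'.1 with hr_def
  have hr : Equivalence r :=
    { refl := fun M => ⟨1, one_smul _ _⟩
      symm := fun {M M'} h => by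
        obtain ⟨u, hu⟩ := h
        exact ⟨u⁻¹, by rw [← hu, inv_smul_smul]⟩
      trans := fun {M M' M''} h h' => by
        obtain ⟨u, hu⟩ := h
        obtain ⟨v, hv⟩ := h'
        exact ⟨v * u, by rw [mul_smul, hu, hv]⟩ }
  -- the normal forms `L_{β/α}` are members of `G(Λ_α)`
  set N : ℕ → Submodule ℤ (ℚ × ℚ) := fun β => span ℤ ({((1 : ℚ), (0 : ℚ)), ((β : ℚ) / α, 1)} : Set (ℚ × ℚ))
    with hN
  have hNG : ∀ β : ℕ, α.Coprime β → IsFullLattice (ℚ × ℚ) (N β) ∧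
      N β / N β = span ℤ ({((α : ℚ), (0 : ℚ)), (1, 1)} : Set (ℚ × ℚ)) ∧ N β * ((N β / N β) / N β) = N β / N β := by
    intro β hcop
    refine ⟨isFullLattice_span_normalForm _, ?_,
      mul_div_div_eq_of_isFullLattice_prod (isFullLattice_span_normalForm _)⟩
    rw [hN]
    dsimp only
    rw [div_self_span_normalForm, (den_div_eq_and_num_div_eq hα hcop).1]
  set NG : {β : ℕ // 2 * β ≤ α ∧ α.Coprime β} → G := fun β => ⟨N β.1, hNG β.1 β.2.2⟩ with hNG_def
  -- every class contains exactly one `L_{β/α}`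
  have hex : ∀ M : G, ∃ β : {β : ℕ // 2 * β ≤ α ∧ α.Coprime β}, r M (NG β) := by
    rintro ⟨M, hM, hMΛ, hMinv⟩
    obtain ⟨u, δ, hδ0, hδ1, huM⟩ := exists_units_smul_eq_span_normalForm hM
    have hO : (u • M) / (u • M) = span ℤ ({((α : ℚ), (0 : ℚ)), (1, 1)} : Set (ℚ × ℚ)) := by
      rw [div_self_units_smul, hMΛ]
    rw [huM, div_self_span_normalForm] at hO
    have hden : δ.den = α := span_order_injective hO
    have hnum0 : 0 ≤ δ.num := Rat.num_nonneg.2 hδ0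
    have hnumq : ((δ.num.toNat : ℕ) : ℚ) = (δ.num : ℚ) := by
      rw [← Int.cast_natCast, Int.toNat_of_nonneg hnum0]
    refine ⟨⟨δ.num.toNat, ?_, ?_⟩, u, ?_⟩
    · have h : (2 * δ.num : ℚ) ≤ δ.den := by
        calc (2 * δ.num : ℚ) = δ.den * (2 * δ) := by rw [mul_left_comm, Rat.den_mul_eq_num]
          _ ≤ δ.den * 1 := mul_le_mul_of_nonneg_left hδ1 (by positivity)
          _ = δ.den := mul_one _
      have h' : 2 * δ.num ≤ (δ.den : ℤ) := by exact_mod_cast h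
      omega
    · have h := δ.reduced
      rw [hden] at h
      have e : δ.num.toNat = δ.num.natAbs := by omega
      rw [e]
      exact h.symm
    · change u • M = N δ.num.toNat
      rw [huM, hN]
      dsimp only
      rw [hnumq, ← hden, Rat.num_div_den]
  choose f hf using hex
  have hU : ∀ β β' : {β : ℕ // 2 * β ≤ α ∧ α.Coprime β}, r (NG β) (NG β') → β = β' := by
    rintro ⟨β, h2β, hβ⟩ ⟨β', h2β', hβ'⟩ ⟨u, hu⟩
    have hαq : (0 : ℚ) < α := by exact_mod_cast hα
    have hle : ∀ {γ : ℕ}, 2 * γ ≤ α → 2 * ((γ : ℚ) / α) ≤ 1 := fun {γ} hγ => by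
      rw [← mul_div_assoc, div_le_one hαq]
      exact_mod_cast hγ
    have hδ := normalForm_unique (by positivity) (hle h2β) (by positivity) (hle h2β') hu
    rw [div_left_inj' hαq.ne'] at hδ
    exact Subtype.ext (by exact_mod_cast hδ)
  have hwd : ∀ M M' : G, r M M' → f M = f M' := fun M M' h =>
    hU _ _ (hr.trans (hr.trans (hr.symm (hf M)) h) (hf M'))
  have hbij : Function.Bijective (Quot.lift f hwd) := by
    constructor
    · rintro ⟨M⟩ ⟨M'⟩ h
      change f M = f M' at h
      exact Quot.sound (hr.trans (hf M) (h ▸ hr.symm (hf M')))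
    · intro β
      exact ⟨Quot.mk r (NG β), hU _ _ (hr.trans (hr.symm (hf (NG β))) (hr.refl _))⟩
  rw [Nat.card_eq_of_bijective _ hbij]
  exact natCard_two_mul_le_coprime hα

end SplitRankTwo

end Literature.NumberTheory.ComplexMultiplication.FiniteQAlgebraLattice
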